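import Literature.Probability.RandomPlanarGeometry.HexSAWBrickWallStripFugacityWidthOneContactLocalCLT
import HarnessLib

/-!
# Corollaries of the local central limit theorem for the contact number: the top wall, the concentration function,
# and point probabilities of order exactly `1/√N` in the central window

Topic `Literature/Probability/RandomPlanarGeometry` (continues `…WidthOneContactLocalCLT.lean`, `contact_localCLT`).  For the Boltzmann
measure `P_{N,y,z}` on the self-avoiding walks of the width-one strip (`y, z > 0`):

* ★ `topContact_localCLT` — the local limit theorem with rate for the TOP contact number `tc` (`z ≠ y + 1`), by the reflection of the strip
  (`sum_filter_topVisits_eq_sum_filter_bottomVisits`, `stripZ₂_symm`).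
* ★★ `contact_pointProb_le` — the concentration function at the optimal scale: for `y ≠ z + 1` there is `C'` with
  `P_{N,y,z}(bc = m) ≤ C'/√N` for every `N ≥ 1` and every integer `m`.
* ★★ `contact_pointProb_ge` — in the central window `|m − N b| ≤ σ√N` the point probabilities are of order exactly `1/√N`:
  there are `c > 0` and `N₀` with `P_{N,y,z}(bc = m) ≥ c/√N` for all `N ≥ N₀` and all such `m`.

## Sources
R. Durrett, *Probability: Theory and Examples* (2019) §3.5 Theorem 3.5.3 (local limit theorem; the corollaries are the lane's statements for
the strip contact number); N. R. Beaton et al., CMP 326 (2014), arXiv:1109.0358v5 §3.2 Proposition 6 (p. 10: symmetry of the two walls).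
Nothing is quoted AS PRINTED (lane «pcv-sawmu», a-p5 g28).
-/

noncomputable section

open MeasureTheory ProbabilityTheory Filter Finset Complex Set
open Literature.Probability.LatticeModels Literature.Probability.Percolation
open scoped Real

namespace Literature.Probability.RandomPlanarGeometry.SAW.HexBW

namespace WidthOneYZ

variable {y z : ℝ}

open Classical in
/-- ★ **THE LOCAL LIMIT THEOREM FOR THE TOP CONTACTS** (reflection of `contact_localCLT`, exchanging the walls): for `y, z > 0` with `z ≠ y + 1`
there is `C` with `|σ_top√N · P_{N,y,z}(tc = m) − (2π)^{−1/2}e^{−((m − N b(z,y))/(σ_top√N))²/2}| ≤ C/√N` for every `N ≥ 1` and integer `m`,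
`σ_top² = d/dB b(e^B, y)|_{B = log z}`. [cite: Durrett2019, §3.5 Theorem 3.5.3 (lane statement); BeatonBousquetMelouDeGierDuminilCopinGuttmann2014, §3.2 Proposition 6 (arXiv v5 p. 10: symmetry of the walls)] -/
theorem topContact_localCLT (hy : 0 < y) (hz : 0 < z) (hzy : z ≠ y + 1) :
    ∃ C : ℝ, ∀ N : ℕ, 1 ≤ N → ∀ m : ℤ,
      |Real.sqrt (deriv (fun B => contactB (Real.exp B) y) (Real.log z)) * Real.sqrt (N : ℝ) *
            ((∑ q ∈ (stripPairs 1 N).filter (fun q => (topVisits₀ 1 q.1 q.2 N : ℝ) = m), wgt y z N q) / stripZ₂ 1 N y z)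
          - (Real.sqrt (2 * π))⁻¹ * Real.exp (-(((m : ℝ) - (N : ℝ) * contactB z y)
              / (Real.sqrt (deriv (fun B => contactB (Real.exp B) y) (Real.log z)) * Real.sqrt (N : ℝ))) ^ 2 / 2)|
        ≤ C / Real.sqrt (N : ℝ) := by
  obtain ⟨C, hC⟩ := contact_localCLT hz hy hzy
  refine ⟨C, fun N hN m => ?_⟩
  rw [sum_filter_topVisits_eq_sum_filter_bottomVisits y z N (fun k => (k : ℝ) = m), stripZ₂_symm 1 N y z]
  exact hC N hN m

open Classical in
/-- ★★ **THE CONCENTRATION FUNCTION OF THE CONTACT NUMBER**: for `y, z > 0`, `y ≠ z + 1` there is `C'` such that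
`P_{N,y,z}(bc = m) ≤ C'/√N` for every `N ≥ 1` and every integer `m` (from `contact_localCLT`: `σ√N·P ≤ (2π)^{−1/2} + C/√N ≤ 1 + C`).
[cite: Durrett2019, §3.5 Theorem 3.5.3 (lane statement: anti-concentration at the CLT scale); BeatonBousquetMelouDeGierDuminilCopinGuttmann2014, §3.2 Proposition 6 (arXiv v5 p. 10)] -/
theorem contact_pointProb_le (hy : 0 < y) (hz : 0 < z) (hyz : y ≠ z + 1) :
    ∃ C' : ℝ, ∀ N : ℕ, 1 ≤ N → ∀ m : ℤ,
      (∑ q ∈ (stripPairs 1 N).filter (fun q => (bottomVisits₀ q.1 q.2 N : ℝ) = m), wgt y z N q) / stripZ₂ 1 N y z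
        ≤ C' / Real.sqrt (N : ℝ) := by
  obtain ⟨C, hC⟩ := contact_localCLT hy hz hyz
  set σ := Real.sqrt (deriv (fun A => contactB (Real.exp A) z) (Real.log y)) with hσ
  have hσpos : 0 < σ := by rw [hσ]; exact Real.sqrt_pos.2 (deriv_contactB_exp_pos hy hz)
  clear_value σ
  have hC0 : 0 ≤ C := by
    have h := hC 1 le_rfl 0
    have : (0 : ℝ) ≤ C / Real.sqrt ((1 : ℕ) : ℝ) := le_trans (abs_nonneg _) h
    simpa using this
  refine ⟨(1 + C) / σ, fun N hN m => ?_⟩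
  have hNpos : (0 : ℝ) < N := by exact_mod_cast hN
  have hsqN : 0 < Real.sqrt (N : ℝ) := Real.sqrt_pos.2 hNpos
  have hsqN1 : 1 ≤ Real.sqrt (N : ℝ) := Real.one_le_sqrt.2 (by exact_mod_cast hN)
  have h := (abs_le.1 (hC N hN m)).2
  have hc1 : (Real.sqrt (2 * π))⁻¹ ≤ 1 := inv_le_one_of_one_le₀ (Real.one_le_sqrt.2 (by linarith [Real.pi_gt_three]))
  have he1 : Real.exp (-(((m : ℝ) - (N : ℝ) * contactB y z) / (σ * Real.sqrt (N : ℝ))) ^ 2 / 2) ≤ 1 :=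
    Real.exp_le_one_iff.2 (by
      have := sq_nonneg (((m : ℝ) - (N : ℝ) * contactB y z) / (σ * Real.sqrt (N : ℝ)))
      linarith)
  have hB1 : (Real.sqrt (2 * π))⁻¹ * Real.exp (-(((m : ℝ) - (N : ℝ) * contactB y z) / (σ * Real.sqrt (N : ℝ))) ^ 2 / 2) ≤ 1 := by
    calc _ ≤ 1 * 1 := mul_le_mul hc1 he1 (Real.exp_pos _).le zero_le_one
      _ = 1 := one_mul _
  have hCN : C / Real.sqrt (N : ℝ) ≤ C := div_le_self hC0 hsqN1
  -- `σ√N·P ≤ 1 + C`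
  have hmain : σ * Real.sqrt (N : ℝ) *
      ((∑ q ∈ (stripPairs 1 N).filter (fun q => (bottomVisits₀ q.1 q.2 N : ℝ) = m), wgt y z N q) / stripZ₂ 1 N y z) ≤ 1 + C := by
    linarith
  rw [le_div_iff₀ hsqN, le_div_iff₀ hσpos]
  calc (∑ q ∈ (stripPairs 1 N).filter (fun q => (bottomVisits₀ q.1 q.2 N : ℝ) = m), wgt y z N q) / stripZ₂ 1 N y z
        * Real.sqrt (N : ℝ) * σ
      = σ * Real.sqrt (N : ℝ) *
          ((∑ q ∈ (stripPairs 1 N).filter (fun q => (bottomVisits₀ q.1 q.2 N : ℝ) = m), wgt y z N q) / stripZ₂ 1 N y z) := by ring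
    _ ≤ 1 + C := hmain

open Classical in
/-- ★★ **POINT PROBABILITIES OF ORDER EXACTLY `1/√N` IN THE CENTRAL WINDOW**: for `y, z > 0`, `y ≠ z + 1` there are `c > 0` and `N₀` such that
for every `N ≥ N₀` and every integer `m` with `|m − N b| ≤ σ√N`, `P_{N,y,z}(bc = m) ≥ c/√N` (from `contact_localCLT`: in the window the Gaussian
density is `≥ (2π)^{−1/2}e^{−1/2}`, and `C/√N` is eventually below half of it). [cite: Durrett2019, §3.5 Theorem 3.5.3 (lane statement); BeatonBousquetMelouDeGierDuminilCopinGuttmann2014, §3.2 Proposition 6 (arXiv v5 p. 10)] -/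
theorem contact_pointProb_ge (hy : 0 < y) (hz : 0 < z) (hyz : y ≠ z + 1) :
    ∃ c : ℝ, ∃ N₀ : ℕ, 0 < c ∧ ∀ N : ℕ, N₀ ≤ N → ∀ m : ℤ,
      |(m : ℝ) - (N : ℝ) * contactB y z| ≤ Real.sqrt (deriv (fun A => contactB (Real.exp A) z) (Real.log y)) * Real.sqrt (N : ℝ) →
        c / Real.sqrt (N : ℝ) ≤
          (∑ q ∈ (stripPairs 1 N).filter (fun q => (bottomVisits₀ q.1 q.2 N : ℝ) = m), wgt y z N q) / stripZ₂ 1 N y z := by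
  obtain ⟨C, hC⟩ := contact_localCLT hy hz hyz
  set σ := Real.sqrt (deriv (fun A => contactB (Real.exp A) z) (Real.log y)) with hσ
  have hσpos : 0 < σ := by rw [hσ]; exact Real.sqrt_pos.2 (deriv_contactB_exp_pos hy hz)
  clear_value σ
  have hC0 : 0 ≤ C := by
    have h := hC 1 le_rfl 0
    have : (0 : ℝ) ≤ C / Real.sqrt ((1 : ℕ) : ℝ) := le_trans (abs_nonneg _) h
    simpa using this
  -- the density floor `g = (2π)^{−1/2} e^{−1/2}` in the window
  obtain ⟨g, hg⟩ : ∃ g : ℝ, g = (Real.sqrt (2 * π))⁻¹ * Real.exp (-(1 / 2 : ℝ)) := ⟨_, rfl⟩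
  have hgpos : 0 < g := by rw [hg]; positivity
  -- threshold: `C/√N ≤ g/2` once `N ≥ (2C/g)² `; take `N₀ = ⌈(2C/g)²⌉₊ + 1`
  refine ⟨g / 2 / σ, ⌈(2 * C / g) ^ 2⌉₊ + 1, by positivity, fun N hN m hm => ?_⟩
  have hN1 : 1 ≤ N := le_trans (Nat.le_add_left 1 _) hN
  have hNpos : (0 : ℝ) < N := by exact_mod_cast hN1
  have hsqN : 0 < Real.sqrt (N : ℝ) := Real.sqrt_pos.2 hNpos
  -- `C/√N ≤ g/2`
  have hCN : C / Real.sqrt (N : ℝ) ≤ g / 2 := by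
    rw [div_le_iff₀ hsqN]
    have h1 : (2 * C / g) ^ 2 ≤ (N : ℝ) := by
      have := Nat.le_ceil ((2 * C / g) ^ 2)
      have h2 : ((⌈(2 * C / g) ^ 2⌉₊ : ℕ) : ℝ) + 1 ≤ N := by exact_mod_cast hN
      linarith
    have h2 : 2 * C / g ≤ Real.sqrt (N : ℝ) := by
      rw [← Real.sqrt_sq (by positivity : (0 : ℝ) ≤ 2 * C / g)]
      exact Real.sqrt_le_sqrt h1
    rw [div_le_iff₀ hgpos] at h2
    linarith
  -- the density at the standardised point is `≥ g`
  have hx : (((m : ℝ) - (N : ℝ) * contactB y z) / (σ * Real.sqrt (N : ℝ))) ^ 2 ≤ 1 := by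
    have hden : 0 < σ * Real.sqrt (N : ℝ) := mul_pos hσpos hsqN
    have h1 : |((m : ℝ) - (N : ℝ) * contactB y z) / (σ * Real.sqrt (N : ℝ))| ≤ 1 := by
      rw [abs_div, abs_of_pos hden, div_le_one hden]; exact hm
    have h2 := abs_nonneg (((m : ℝ) - (N : ℝ) * contactB y z) / (σ * Real.sqrt (N : ℝ)))
    nlinarith [sq_abs (((m : ℝ) - (N : ℝ) * contactB y z) / (σ * Real.sqrt (N : ℝ))), h1, h2]
  have hdens : g ≤ (Real.sqrt (2 * π))⁻¹ * Real.exp (-(((m : ℝ) - (N : ℝ) * contactB y z) / (σ * Real.sqrt (N : ℝ))) ^ 2 / 2) := by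
    rw [hg]
    exact mul_le_mul_of_nonneg_left (Real.exp_le_exp.2 (by linarith)) (by positivity)
  have h := (abs_le.1 (hC N hN1 m)).1
  -- `σ√N·P ≥ g − C/√N ≥ g/2`
  have hmain : g / 2 ≤ σ * Real.sqrt (N : ℝ) *
      ((∑ q ∈ (stripPairs 1 N).filter (fun q => (bottomVisits₀ q.1 q.2 N : ℝ) = m), wgt y z N q) / stripZ₂ 1 N y z) := by
    linarith
  rw [div_le_iff₀ hsqN, div_le_iff₀ hσpos]
  calc g / 2 ≤ _ := hmain
    _ = (∑ q ∈ (stripPairs 1 N).filter (fun q => (bottomVisits₀ q.1 q.2 N : ℝ) = m), wgt y z N q) / stripZ₂ 1 N y z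
        * Real.sqrt (N : ℝ) * σ := by ring

end WidthOneYZ

end Literature.Probability.RandomPlanarGeometry.SAW.HexBW

end
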